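import Summits.Ventures.PercRepro.Night2ThreeFatCellsA
import Summits.Ventures.PercRepro.Night2TwoFatCellsH

/-!
# PercRepro — the `(7, 5)` cells `(3, 0)` at `|G| = 10, 12` through three disjoint fat hyperplanes, and the residues I
(night-2, gen 23)

The three-disjoint-hyperplane count of `Night2ThreeFatCount` with the chord excess of gen 20 gives the count sums
`1.022` at `(3, 0)`, `n = 10` and `1.012` at `n = 12` (`n = 11`: `0.932`, open): the cells `(3, 0)` at `|G| = 10` and
`|G| = 12` close whenever three fat thin members miss pairwise disjoint sets.  Together with the `(3, 1)` cells of
`Night2ThreeFatCellsA`: **`shadowHall_seven_five_of_residuesI`** — the `(7, 5)` shadow row for every finite matroid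
modulo the residues H with the extra clause `NoThreeDisjointFat N G 2` (every three thin members missing `≤ 2` points
have two with MEETING missed sets) at `(3, 0)`, `|G| ∈ {10, 12}` and at `(3, 1)`, `11 ≤ |G| ≤ 15`.
-/

namespace PercRepro.Shadow

open Finset PerFlat ThmH

/-- The count sum of the cell `(3, 0)` at `n = 10` with the three-disjoint-hyperplane count and `E = 41 / 120`:
`1.022 ≥ 1`. -/
theorem countSum_three_zero_ten_d3 :
    1 ≤ countSum 10 6 3 (cPrimeDGP 5 3 6 0 2) (41 / 120 : ℚ) (cntDisjThree 6) := by
  rw [cPrimeDGP_three_zero_two]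
  unfold countSum DGenP.cjG cntDisjThree
  rw [show Finset.Icc 1 (10 - 6) = {1, 2, 3, 4} by decide]
  repeat rw [Finset.sum_insert (by decide)]
  rw [Finset.sum_singleton]
  norm_num [Nat.choose_eq_descFactorial_div_factorial, Nat.descFactorial, Nat.factorial]

/-- The count sum of the cell `(3, 0)` at `n = 12` with the three-disjoint-hyperplane count and `E = 13 / 50`:
`1.012 ≥ 1`. -/
theorem countSum_three_zero_twelve_d3 :
    1 ≤ countSum 12 6 3 (cPrimeDGP 5 3 6 0 2) (13 / 50 : ℚ) (cntDisjThree 6) := by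
  rw [cPrimeDGP_three_zero_two]
  unfold countSum DGenP.cjG cntDisjThree
  rw [show Finset.Icc 1 (12 - 6) = {1, 2, 3, 4, 5, 6} by decide]
  repeat rw [Finset.sum_insert (by decide)]
  rw [Finset.sum_singleton]
  norm_num [Nat.choose_eq_descFactorial_div_factorial, Nat.descFactorial, Nat.factorial]

variable {α : Type*} [DecidableEq α] {M : Matroid α} [M.Finite]

open scoped Classical in
/-- **The cell `(3, 0)` at `|G| = 10` with three fat thin members missing pairwise DISJOINT sets** (`≤ 2` points each):
(LI_G) through the three-disjoint-hyperplane count of the covering bases. -/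
theorem localShadowHall_three_zero_six_ten_of_threeDisjoint {G : Finset α} (hG : G ∈ flatsQ M (5 + 1))
    (hd : (gr M \ G).card = 3) (hk : kColoops M G = 0)
    (hs : ∀ e ∈ gr M, ∀ f ∈ gr M, e ≠ f → rkN M {e, f} = 2) (hl : ∀ e ∈ gr M, M.Indep {e})
    (hn : G.card = 10) {B₀ B₁ B₂ : Finset α} (hB₀ : B₀ ∈ thinMembers M 5 G) (hB₁ : B₁ ∈ thinMembers M 5 G)
    (hB₂ : B₂ ∈ thinMembers M 5 G)
    (hfat₀ : (G \ clF M B₀).card ≤ 2) (hfat₁ : (G \ clF M B₁).card ≤ 2) (hfat₂ : (G \ clF M B₂).card ≤ 2)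
    (hd₀₁ : (G \ clF M B₀) ∩ (G \ clF M B₁) = ∅) (hd₀₂ : (G \ clF M B₀) ∩ (G \ clF M B₂) = ∅)
    (hd₁₂ : (G \ clF M B₁) ∩ (G \ clF M B₂) = ∅) :
    LocalShadowHall M 5 G := by
  have hk' : kColoops M G + 6 = 5 + 1 := by omega
  have hd' : (gr M \ G).card ≤ 5 := by omega
  have hm2 : ∀ B ∈ thinMembers M 5 G, 6 ≤ (B \ coloops M G).card → 2 ≤ (G \ clF M B).card :=
    fun B hB _ => two_le_card_sdiff_of_not_lay0 hG hd' (mem_thinMembers.1 hB).1 (mem_thinMembers.1 hB).2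
  have hc2 : 0 ≤ cPrimeDGP 5 3 6 (kColoops M G) 2 := by
    rw [hk]; unfold cPrimeDGP capDG reqDGP phiQ; norm_num
  have hn' : G.card - kColoops M G = 10 := by omega
  have hKG : coloops M G ⊆ G := fun y hy => (mem_coloops.1 hy).1
  have hnK : (G \ coloops M G).card = 10 := by
    rw [Finset.card_sdiff_of_subset hKG, ← kColoops_eq_card_coloops]; omega
  refine localShadowHall_excess_of_count (d := 3) (ρ := 6) (m₁ := 2) hG hd (by norm_num) hk' (by norm_num)
    hs hl hc2 hm2 (E := (41 / 120 : ℚ)) (by norm_num) ?_ (cnt := cntDisjThree 6) ?_ ?_ ?_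
  · intro S _ T hT
    have hT' : T ∈ (S \ coloops M G).powersetCard 6 := by
      unfold coverBases at hT
      exact (Finset.mem_filter.1 hT).1
    have h := sum_faceLoss_union_le (a := (1 / 4 : ℚ)) (b := (1 / 40 : ℚ)) hG hd (by norm_num) hk' (by omega)
      hs hl (by norm_num) (by rw [hnK]; intro m h1 h2; exact DGenP.chord_three_zero_10 m h1 (by omega))
      (by rw [hnK, hk, DGenP.excessBound_three_zero_10]; norm_num) hT'
    rw [hnK, hk, DGenP.excessBound_three_zero_10] at h
    exact h
  · intro s h1 h2
    rw [hn'] at h2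
    exact cntDisjThree_six_pos s h1 (by omega)
  · intro S hSG
    exact card_coverBases_le_cntDisjThree hk' (by norm_num) (coloops_subset_clF_of_mem_thinMembers hG hd' hB₀)
      (eRk_clF_le_of_mem_thinMembers hB₀) (coloops_subset_clF_of_mem_thinMembers hG hd' hB₁)
      (eRk_clF_le_of_mem_thinMembers hB₁) (coloops_subset_clF_of_mem_thinMembers hG hd' hB₂)
      (eRk_clF_le_of_mem_thinMembers hB₂) hfat₀ hfat₁ hfat₂ hd₀₁ hd₀₂ hd₁₂ hSG
  · rw [hn', hk]
    exact countSum_three_zero_ten_d3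

open scoped Classical in
/-- **The cell `(3, 0)` at `|G| = 12` with three fat thin members missing pairwise DISJOINT sets** (`≤ 2` points each):
(LI_G) through the three-disjoint-hyperplane count of the covering bases. -/
theorem localShadowHall_three_zero_six_twelve_of_threeDisjoint {G : Finset α} (hG : G ∈ flatsQ M (5 + 1))
    (hd : (gr M \ G).card = 3) (hk : kColoops M G = 0)
    (hs : ∀ e ∈ gr M, ∀ f ∈ gr M, e ≠ f → rkN M {e, f} = 2) (hl : ∀ e ∈ gr M, M.Indep {e})
    (hn : G.card = 12) {B₀ B₁ B₂ : Finset α} (hB₀ : B₀ ∈ thinMembers M 5 G) (hB₁ : B₁ ∈ thinMembers M 5 G)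
    (hB₂ : B₂ ∈ thinMembers M 5 G)
    (hfat₀ : (G \ clF M B₀).card ≤ 2) (hfat₁ : (G \ clF M B₁).card ≤ 2) (hfat₂ : (G \ clF M B₂).card ≤ 2)
    (hd₀₁ : (G \ clF M B₀) ∩ (G \ clF M B₁) = ∅) (hd₀₂ : (G \ clF M B₀) ∩ (G \ clF M B₂) = ∅)
    (hd₁₂ : (G \ clF M B₁) ∩ (G \ clF M B₂) = ∅) :
    LocalShadowHall M 5 G := by
  have hk' : kColoops M G + 6 = 5 + 1 := by omega
  have hd' : (gr M \ G).card ≤ 5 := by omega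
  have hm2 : ∀ B ∈ thinMembers M 5 G, 6 ≤ (B \ coloops M G).card → 2 ≤ (G \ clF M B).card :=
    fun B hB _ => two_le_card_sdiff_of_not_lay0 hG hd' (mem_thinMembers.1 hB).1 (mem_thinMembers.1 hB).2
  have hc2 : 0 ≤ cPrimeDGP 5 3 6 (kColoops M G) 2 := by
    rw [hk]; unfold cPrimeDGP capDG reqDGP phiQ; norm_num
  have hn' : G.card - kColoops M G = 12 := by omega
  have hKG : coloops M G ⊆ G := fun y hy => (mem_coloops.1 hy).1
  have hnK : (G \ coloops M G).card = 12 := by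
    rw [Finset.card_sdiff_of_subset hKG, ← kColoops_eq_card_coloops]; omega
  refine localShadowHall_excess_of_count (d := 3) (ρ := 6) (m₁ := 2) hG hd (by norm_num) hk' (by norm_num)
    hs hl hc2 hm2 (E := (13 / 50 : ℚ)) (by norm_num) ?_ (cnt := cntDisjThree 6) ?_ ?_ ?_
  · intro S _ T hT
    have hT' : T ∈ (S \ coloops M G).powersetCard 6 := by
      unfold coverBases at hT
      exact (Finset.mem_filter.1 hT).1
    have h := sum_faceLoss_union_le (a := (6 / 25 : ℚ)) (b := (1 / 50 : ℚ)) hG hd (by norm_num) hk' (by omega)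
      hs hl (by norm_num) (by rw [hnK]; intro m h1 h2; exact DGenP.chord_three_zero_12 m h1 (by omega))
      (by rw [hnK, hk, DGenP.excessBound_three_zero_12]; norm_num) hT'
    rw [hnK, hk, DGenP.excessBound_three_zero_12] at h
    exact h
  · intro s h1 h2
    rw [hn'] at h2
    exact cntDisjThree_six_pos s h1 (by omega)
  · intro S hSG
    exact card_coverBases_le_cntDisjThree hk' (by norm_num) (coloops_subset_clF_of_mem_thinMembers hG hd' hB₀)
      (eRk_clF_le_of_mem_thinMembers hB₀) (coloops_subset_clF_of_mem_thinMembers hG hd' hB₁)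
      (eRk_clF_le_of_mem_thinMembers hB₁) (coloops_subset_clF_of_mem_thinMembers hG hd' hB₂)
      (eRk_clF_le_of_mem_thinMembers hB₂) hfat₀ hfat₁ hfat₂ hd₀₁ hd₀₂ hd₁₂ hSG
  · rw [hn', hk]
    exact countSum_three_zero_twelve_d3

section SevenFiveI

variable {α' : Type} [DecidableEq α']

/-- «every three thin members missing `≤ m` points have two with MEETING missed sets» — the fat missed sets contain no
three pairwise disjoint members. -/
abbrev NoThreeDisjointFat (N : Matroid α') [N.Finite] (G : Finset α') (m : ℕ) : Prop :=
  ∀ B₀ ∈ thinMembers N 5 G, ∀ B₁ ∈ thinMembers N 5 G, ∀ B₂ ∈ thinMembers N 5 G,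
    (G \ clF N B₀).card ≤ m → (G \ clF N B₁).card ≤ m → (G \ clF N B₂).card ≤ m →
      (G \ clF N B₀) ∩ (G \ clF N B₁) ≠ ∅ ∨ (G \ clF N B₀) ∩ (G \ clF N B₂) ≠ ∅ ∨
        (G \ clF N B₁) ∩ (G \ clF N B₂) ≠ ∅

/-- **THE `(7, 5)` SHADOW ROW FOR EVERY FINITE MATROID MODULO THE RESIDUES I**: the residues of
`shadowHall_seven_five_of_residuesH` with the extra clause `NoThreeDisjointFat N G 2` at `(3, 0)`, `|G| ∈ {10, 12}` and
at `(3, 1)`, `11 ≤ |G| ≤ 15`. -/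
theorem shadowHall_seven_five_of_residuesI
    (h20 : ∀ (N : Matroid α') [N.Finite] (G : Finset α'), CellHyp N G →
      (gr N \ G).card = 2 → kColoops N G = 0 → FatMember N G 6 3 →
      (FatBasis N G 6 2 ∨ FatMember N G 6 2) → LocalShadowHall N 5 G)
    (h21 : ∀ (N : Matroid α') [N.Finite] (G : Finset α'), CellHyp N G →
      (gr N \ G).card = 2 → kColoops N G = 1 → FatMember N G 5 4 →
      (FatBasis N G 5 3 ∨ FatMember N G 5 3) → LocalShadowHall N 5 G)
    (h30 : ∀ (N : Matroid α') [N.Finite] (G : Finset α'), CellHyp N G →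
      (gr N \ G).card = 3 → kColoops N G = 0 → 10 ≤ G.card → G.card ≤ 13 → FatMember N G 6 2 →
      FatBasis N G 6 2 → (G.card = 13 → NestedFat N G 2 3) →
      (G.card = 10 ∨ G.card = 12 → NoThreeDisjointFat N G 2) → LocalShadowHall N 5 G)
    (h31 : ∀ (N : Matroid α') [N.Finite] (G : Finset α'), CellHyp N G →
      (gr N \ G).card = 3 → kColoops N G = 1 → 11 ≤ G.card → G.card ≤ 17 → FatMember N G 5 2 →
      (G.card = 17 → FatBasis N G 5 2) → (G.card = 17 → NestedFat N G 2 3) →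
      (G.card = 16 → MeetingFat N G 2) → (11 ≤ G.card ∧ G.card ≤ 15 → NoThreeDisjointFat N G 2) →
      (G.card = 11 ∨ G.card = 15 ∨ G.card = 16 → FatBasis N G 5 3) →
      (12 ≤ G.card ∧ G.card ≤ 14 → FatBasis N G 5 4) → LocalShadowHall N 5 G)
    (h32 : ∀ (N : Matroid α') [N.Finite] (G : Finset α'), CellHyp N G →
      (gr N \ G).card = 3 → kColoops N G = 2 → FatMember N G 4 2 → LocalShadowHall N 5 G)
    (M : Matroid α') [M.Finite] : ShadowHall M 7 5 (phiK 7 5) := by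
  apply shadowHall_seven_five_of_residuesH h20 h21 _ _ h32
  · intro N _ G hcell hd hk h10 h13 hfm hfb hnest
    by_cases hnd : NoThreeDisjointFat N G 2
    · exact h30 N G hcell hd hk h10 h13 hfm hfb hnest (fun _ => hnd)
    · unfold NoThreeDisjointFat at hnd
      push Not at hnd
      obtain ⟨B₀, hB₀, B₁, hB₁, B₂, hB₂, hf₀, hf₁, hf₂, hd₀₁, hd₀₂, hd₁₂⟩ := hnd
      by_cases hG10 : G.card = 10
      · exact localShadowHall_three_zero_six_ten_of_threeDisjoint hcell.2.2.2 hd hk hcell.1 hcell.2.1 hG10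
          hB₀ hB₁ hB₂ hf₀ hf₁ hf₂ hd₀₁ hd₀₂ hd₁₂
      by_cases hG12 : G.card = 12
      · exact localShadowHall_three_zero_six_twelve_of_threeDisjoint hcell.2.2.2 hd hk hcell.1 hcell.2.1 hG12
          hB₀ hB₁ hB₂ hf₀ hf₁ hf₂ hd₀₁ hd₀₂ hd₁₂
      · refine h30 N G hcell hd hk h10 h13 hfm hfb hnest (fun h => ?_)
        rcases h with h | h
        · exact absurd h hG10
        · exact absurd h hG12
  · intro N _ G hcell hd hk h11 h17 hfm hb2 hnest hmeet hb3 hb4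
    by_cases hnd : NoThreeDisjointFat N G 2
    · exact h31 N G hcell hd hk h11 h17 hfm hb2 hnest hmeet (fun _ => hnd) hb3 hb4
    · unfold NoThreeDisjointFat at hnd
      push Not at hnd
      obtain ⟨B₀, hB₀, B₁, hB₁, B₂, hB₂, hf₀, hf₁, hf₂, hd₀₁, hd₀₂, hd₁₂⟩ := hnd
      by_cases hG11 : G.card = 11
      · exact localShadowHall_three_one_five_eleven_of_threeDisjoint hcell.2.2.2 hd hk hcell.1 hcell.2.1 hG11
          hB₀ hB₁ hB₂ hf₀ hf₁ hf₂ hd₀₁ hd₀₂ hd₁₂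
      by_cases hG12 : G.card = 12
      · exact localShadowHall_three_one_five_twelve_of_threeDisjoint hcell.2.2.2 hd hk hcell.1 hcell.2.1 hG12
          hB₀ hB₁ hB₂ hf₀ hf₁ hf₂ hd₀₁ hd₀₂ hd₁₂
      by_cases hG13 : G.card = 13
      · exact localShadowHall_three_one_five_thirteen_of_threeDisjoint hcell.2.2.2 hd hk hcell.1 hcell.2.1 hG13
          hB₀ hB₁ hB₂ hf₀ hf₁ hf₂ hd₀₁ hd₀₂ hd₁₂
      by_cases hG14 : G.card = 14
      · exact localShadowHall_three_one_five_fourteen_of_threeDisjoint hcell.2.2.2 hd hk hcell.1 hcell.2.1 hG14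
          hB₀ hB₁ hB₂ hf₀ hf₁ hf₂ hd₀₁ hd₀₂ hd₁₂
      by_cases hG15 : G.card = 15
      · exact localShadowHall_three_one_five_fifteen_of_threeDisjoint hcell.2.2.2 hd hk hcell.1 hcell.2.1 hG15
          hB₀ hB₁ hB₂ hf₀ hf₁ hf₂ hd₀₁ hd₀₂ hd₁₂
      · exact h31 N G hcell hd hk h11 h17 hfm hb2 hnest hmeet (fun h => absurd h (by omega)) hb3 hb4

end SevenFiveI

end PercRepro.Shadow
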